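import Literature.Probability.RandomPlanarGeometry.HexSAWStripBetaCoefficientLaw
import Literature.Probability.RandomPlanarGeometry.HexSAWStripSurfaceCoeffIdentity
import Literature.Probability.RandomPlanarGeometry.HexSAWStripSurfaceWidthOneThreshold
import HarnessLib

/-!
# The β-coefficients of width one, exactly: `β_{1,m} = 2 x_c^{2m}` (`m ≥ 1`), and the coefficient law / residue of `B_T(x_c; ·)`
# for EVERY width `T ≥ 1` (module «BETA-COEFF-ALL-T»)

Topic `Literature/Probability/RandomPlanarGeometry` (continues «BETA-COEFF» `HexSAWStripBetaCoefficientLaw.lean` — `β_{T,m} y_T^m → Λ_T > 0`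
and `(y_T − y) B_T(x_c; y) → Λ_T y_T` for `T ≥ 2` —, `HexSAWStripSurfaceWidthOne.lean` / `HexSAWStripSurfaceWidthOneThreshold.lean`
(`HV.stripGFy_beta_one_eq : B_{1,L}(x_c; y) = 2 Σ_{k=1}^{L+1} (x_c² y)^k`, `HV.stripYT_one`, `HV.hexCriticalFugacity_sq_mul_stripYT_one :
x_c² y_1 = 1`) and the polynomial bookkeeping of `HexSAWStripSurfaceCoeffIdentity.lean` (`HV.stripCpoly`, `HV.eval_stripCpoly`,
`HV.coeff_stripCpoly`)).  Lane «pcv-sawmu» (CriticalPhenomena venture), a-p2 g21.  Source of the SETTING: N. R. Beaton, M. Bousquet-Mélou,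
J. de Gier, H. Duminil-Copin, A. J. Guttmann, CMP 326 (2014), arXiv:1109.0358v5, §3.2 and the proof of Proposition 5 (p. 9: the width-one
strip), Corollary 8 (p. 12: `y_T`).  The width-one count is elementary (two zig-zag walks of each even length); the all-`T` statements
combine it with «BETA-COEFF».

## What is proved (namespace `Literature.Probability.RandomPlanarGeometry.SAW.HV`)

* `stripCpoly_beta_one_eq` — `B_{1,L}` as a polynomial: `Σ_m β_{1,L,m} X^m = Σ_{k=1}^{L+1} 2 x_c^{2k} X^k`;
  ★ `stripBcoeffY_one_eq` — `β_{1,L,m} = 2 x_c^{2m}` for `1 ≤ m ≤ L + 1` and `0` otherwise; ★ `stripBcoeff_one_eq` — `β_{1,m} = 2 x_c^{2m}`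
  for `m ≥ 1` (`β_{1,0} = 0`); ★ `stripBcoeff_one_mul_pow_eq` — `β_{1,m} · y_1^m = 2` for `m ≥ 1`, so `β_{1,m} y_1^m → 2`.
* ★★ `tendsto_sub_mul_stripByLim_of_tendsto` — the Abelian step for every `T ≥ 1`: if `β_{T,m} y_T^m → Λ > 0` then
  `(y_T − y) · B_T(x_c; y) → Λ · y_T` as `y ↑ y_T`.
* ★★★ `exists_pos_tendsto_stripBcoeff_mul_pow_of_one_le` — for EVERY `T ≥ 1`: `∃ Λ_T > 0, β_{T,m} · y_T^m → Λ_T`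
  (`Λ_1 = 2`; `T ≥ 2` is «BETA-COEFF»); ★★★ `exists_tendsto_sub_mul_stripByLim_of_one_le` — for every `T ≥ 1`,
  `(y_T − y) · B_T(x_c; y) → Λ_T · y_T` (in particular `β_{T,m} y_T^m ↛ 0` — the no-decay statement of the tree's threshold
  bootstrap `not_tendsto_zero_stripBcoeff_mul_stripYT_pow`, there conditional on (E) and (C), holds with a positive LIMIT).

Label: LANE THEOREM (own; the width-one count is elementary / folklore made formal).  NOT claimed: uniformity in `T`, a rate.
-/

noncomputable section

open Finset Filter Topology Polynomial Literature.Probability.LatticeModels Literature.Probability.Percolation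

namespace Literature.Probability.RandomPlanarGeometry.SAW

namespace HV

/-! ### §1 Width one: the β-coefficients exactly -/

/-- `B_{1,L}` as a polynomial in the surface fugacity: `Σ_m β_{1,L,m} X^m = Σ_{k=1}^{L+1} 2 x_c^{2k} X^k` (two zig-zag walks of length `2k`
with `k` contacts each). [cite: BeatonBousquetMelouDeGierDuminilCopinGuttmann2014, proof of Proposition 5 (arXiv v5 p. 9: the width-one strip) and §3.2; lane: coefficient extraction] -/
theorem stripCpoly_beta_one_eq (L : ℕ) :
    stripCpoly 1 L (IsBetaDart 1) = ∑ k ∈ Icc 1 (L + 1), C (2 * (hexCriticalFugacity ^ 2) ^ k) * X ^ k := by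
  refine Polynomial.funext fun y => ?_
  rw [eval_stripCpoly, stripGFy_beta_one_eq, eval_finsetSum, mul_sum]
  refine sum_congr rfl fun k _ => ?_
  rw [eval_mul, eval_C, eval_pow, eval_X, mul_pow]
  ring

/-- ★ **`β_{1,L,m} = 2 x_c^{2m}` for `1 ≤ m ≤ L + 1`, and `0` otherwise.** [cite: BeatonBousquetMelouDeGierDuminilCopinGuttmann2014, proof of Proposition 5 (arXiv v5 p. 9) and §3.2; lane: exact width-one count] -/
theorem stripBcoeffY_one_eq (L m : ℕ) :
    stripBcoeffY 1 L m = if 1 ≤ m ∧ m ≤ L + 1 then 2 * hexCriticalFugacity ^ (2 * m) else 0 := by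
  have h := coeff_stripCpoly 1 L (IsBetaDart 1) m
  rw [stripCcoeffY_beta] at h
  rw [← h, stripCpoly_beta_one_eq, finsetSum_coeff]
  simp only [coeff_C_mul, coeff_X_pow, mul_ite, mul_one, mul_zero]
  rw [Finset.sum_ite_eq]
  simp only [mem_Icc, ← pow_mul]

/-- ★ **`β_{1,m} = 2 x_c^{2m}` for `m ≥ 1`** (the box `S_{1,m}` already carries both zig-zags with `m` contacts; larger boxes add nothing).
[cite: BeatonBousquetMelouDeGierDuminilCopinGuttmann2014, proof of Proposition 5 (arXiv v5 p. 9) and Corollary 8 (p. 12); lane: exact width-one count] -/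
theorem stripBcoeff_one_eq {m : ℕ} (hm : 1 ≤ m) : stripBcoeff 1 m = 2 * hexCriticalFugacity ^ (2 * m) := by
  have ht := tendsto_stripBcoeffY le_rfl m (T := 1)
  have hev : ∀ᶠ L : ℕ in atTop, stripBcoeffY 1 L m = 2 * hexCriticalFugacity ^ (2 * m) := by
    filter_upwards [eventually_ge_atTop m] with L hL
    rw [stripBcoeffY_one_eq, if_pos ⟨hm, by omega⟩]
  exact tendsto_nhds_unique ht (tendsto_const_nhds.congr' (hev.mono fun L hL => hL.symm))

/-- ★ **`β_{1,m} · y_1^m = 2` for `m ≥ 1`** (`x_c² y_1 = 1`). [cite: BeatonBousquetMelouDeGierDuminilCopinGuttmann2014, Corollary 8 (arXiv v5 p. 12); lane: `stripYT_one`] -/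
theorem stripBcoeff_one_mul_pow_eq {m : ℕ} (hm : 1 ≤ m) : stripBcoeff 1 m * stripYT 1 ^ m = 2 := by
  rw [stripBcoeff_one_eq hm, pow_mul, mul_assoc, ← mul_pow, hexCriticalFugacity_sq_mul_stripYT_one, one_pow, mul_one]

/-- `β_{1,m} · y_1^m → 2`. [cite: BeatonBousquetMelouDeGierDuminilCopinGuttmann2014, Corollary 8 (arXiv v5 p. 12); lane] -/
theorem tendsto_stripBcoeff_one_mul_pow : Tendsto (fun m : ℕ => stripBcoeff 1 m * stripYT 1 ^ m) atTop (𝓝 2) :=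
  tendsto_const_nhds.congr' ((eventually_ge_atTop 1).mono fun _ hm => (stripBcoeff_one_mul_pow_eq hm).symm)

/-! ### §2 The Abelian step for every width, and the laws for every `T ≥ 1` -/

variable {T : ℕ}

/-- ★★ **Abelian step** (`T ≥ 1`): if `β_{T,m} · y_T^m → Λ > 0` then `(y_T − y) · B_T(x_c; y) → Λ · y_T` as `y ↑ y_T`
(`B_T(x_c; y) = Σ_m β_{T,m} y^m` below `y_T`; Cesàro averages of a convergent sequence and the easy half of the tree's Hardy–Littlewood
theorem in the variable `s = y/y_T`). [cite: Feller1971, XIII.5 Theorem 5 (easy half); BeatonBousquetMelouDeGierDuminilCopinGuttmann2014, Corollary 8 (arXiv v5 p. 12); lane «pcv-sawmu» a-p2 g21] -/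
theorem tendsto_sub_mul_stripByLim_of_tendsto (hT : 1 ≤ T) {Λ : ℝ} (hΛ : 0 < Λ)
    (h : Tendsto (fun m : ℕ => stripBcoeff T m * stripYT T ^ m) atTop (𝓝 Λ)) :
    Tendsto (fun y : ℝ => (stripYT T - y) * stripByLim T y) (𝓝[<] stripYT T) (𝓝 (Λ * stripYT T)) := by
  have hyT := one_lt_stripYT hT
  have hy : 0 < stripYT T := by linarith
  set q : ℕ → ℝ := fun m => stripBcoeff T m * stripYT T ^ m with hq
  have hq0 : ∀ m, 0 ≤ q m := fun m => mul_nonneg (stripBcoeff_nonneg hT m) (pow_nonneg hy.le _)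
  have habel : Tendsto (fun s : ℝ => (1 - s) * ∑' m, q m * s ^ m) (𝓝[<] 1) (𝓝 Λ) := by
    have hces : Tendsto (fun n : ℕ => (∑ k ∈ range n, q k) / (n : ℝ) ^ (1 : ℝ)) atTop (𝓝 (Λ / Real.Gamma (1 + 1))) := by
      have h2 : Real.Gamma (1 + 1) = 1 := by norm_num [Real.Gamma_two]
      rw [h2, div_one]
      refine h.cesaro.congr fun n => ?_
      rw [Real.rpow_one, div_eq_inv_mul]
    have hA := ((Literature.Analysis.Asymptotics.hardyLittlewood_powerSeries_iff hq0 zero_le_one hΛ).mpr hces).2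
    refine hA.congr fun s => ?_
    rw [Real.rpow_one]
  have hsub : Tendsto (fun y : ℝ => y / stripYT T) (𝓝[<] stripYT T) (𝓝[<] 1) := by
    refine tendsto_nhdsWithin_of_tendsto_nhds_of_eventually_within _ ?_ ?_
    · have : Tendsto (fun y : ℝ => y / stripYT T) (𝓝 (stripYT T)) (𝓝 (stripYT T / stripYT T)) := tendsto_id.div_const _
      rw [div_self hy.ne'] at this
      exact this.mono_left nhdsWithin_le_nhds
    · filter_upwards [self_mem_nhdsWithin] with y hy'
      exact (div_lt_one hy).2 hy'
  have h1 := (habel.comp hsub).mul_const (stripYT T)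
  refine h1.congr' ?_
  filter_upwards [Ico_mem_nhdsLT hyT] with y hyI
  have hy0' : 0 ≤ y := zero_le_one.trans hyI.1
  simp only [Function.comp, hq]
  rw [stripByLim_eq_tsum hT (mem_stripBddSet_of_lt_stripYT hT hy0' hyI.2)]
  have hterm : ∀ m, stripBcoeff T m * stripYT T ^ m * (y / stripYT T) ^ m = stripBcoeff T m * y ^ m := fun m => by
    rw [div_pow, mul_assoc, mul_div_assoc', mul_div_cancel_left₀ _ (pow_ne_zero _ hy.ne')]
  simp_rw [hterm]
  field_simp

/-- ★★★ **THE COEFFICIENT LAW FOR EVERY WIDTH `T ≥ 1`**: `∃ Λ_T > 0, β_{T,m} · y_T^m → Λ_T` (`Λ_1 = 2` by the exact width-one count;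
`T ≥ 2` is «BETA-COEFF»'s `exists_pos_tendsto_stripBcoeff_mul_pow`). [cite: BeatonBousquetMelouDeGierDuminilCopinGuttmann2014, §3.2 and Corollary 8 (arXiv v5 p. 12); DuminilCopinHammond2013, §2.2; lane «pcv-sawmu», a-p2 g21 — own result] -/
theorem exists_pos_tendsto_stripBcoeff_mul_pow_of_one_le (hT : 1 ≤ T) :
    ∃ Λ : ℝ, 0 < Λ ∧ Tendsto (fun m : ℕ => stripBcoeff T m * stripYT T ^ m) atTop (𝓝 Λ) := by
  rcases Nat.lt_or_ge T 2 with h | h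
  · obtain rfl : T = 1 := by omega
    exact ⟨2, two_pos, tendsto_stripBcoeff_one_mul_pow⟩
  · exact exists_pos_tendsto_stripBcoeff_mul_pow h

/-- ★★★ **THE RESIDUE OF `B_T(x_c; ·)` AT ITS RADIUS FOR EVERY WIDTH `T ≥ 1`**: `∃ Λ_T > 0` with `β_{T,m} y_T^m → Λ_T` and
`(y_T − y) · B_T(x_c; y) → Λ_T · y_T` as `y ↑ y_T`. [cite: BeatonBousquetMelouDeGierDuminilCopinGuttmann2014, Corollary 8 (arXiv v5 p. 12); Feller1971, XIII.5 Theorem 5 (easy half); lane «pcv-sawmu», a-p2 g21 — own result] -/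
theorem exists_tendsto_sub_mul_stripByLim_of_one_le (hT : 1 ≤ T) :
    ∃ Λ : ℝ, 0 < Λ ∧ Tendsto (fun m : ℕ => stripBcoeff T m * stripYT T ^ m) atTop (𝓝 Λ) ∧
      Tendsto (fun y : ℝ => (stripYT T - y) * stripByLim T y) (𝓝[<] stripYT T) (𝓝 (Λ * stripYT T)) := by
  obtain ⟨Λ, hΛ, h⟩ := exists_pos_tendsto_stripBcoeff_mul_pow_of_one_le hT
  exact ⟨Λ, hΛ, h, tendsto_sub_mul_stripByLim_of_tendsto hT hΛ h⟩

end HV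

end Literature.Probability.RandomPlanarGeometry.SAW
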